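import Mathlib

/-!
# T4OneStepKernel1D — the one-dimensional block-mean model of the ONE-STEP CLASSICAL CORRECTION: the double block average of the kernel |x − y| (cell `pub-balaban`, T4-DAG node U1b, NEW ESTIMATE NE3, prover seat P1; first rung of the sub-estimate OSC-lin of HOME/t4/T4-EST-NE3-P1.md §5; toy model, kernel-checked combinatorics)

HONEST FRAMING (cell `pub-balaban`, T4-DAG PAGE 1).  Rung (B)+1 of the cell's ladder concerns a FIXED finite
four-torus; NOT infinite volume, NOT the mass gap, NOT Clay.  This module is a ONE-DIMENSIONAL SCALAR TOY with
block MEANS in place of Bałaban's averaging operations: it proves two finite-sum identities and NOTHING about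
Bałaban's minimisers, propagators or norms.  Its role (record HOME/t4/T4-EST-NE3-P1.md §4.3, §5, GAPS G-ne3p1-1,
G-ne3p1-5): the record reduces the η-rate of the minimisers (NE3) EXACTLY to the estimate OSC on the propagated
derivative of the one-step classical correction δA = (one-step effective action) − (bare action), and predicts from
the linear layer that D(δA) is a bounded FOURTH-ORDER lattice operator applied to the background ("two extra
derivatives", physically κ_L η²∇⁴).  In the 1D block-mean model this is an EXACT closed form, whose combinatorial core
is the identity proved here.  Value = a kernel-checked toy identity supporting one sentence of the record; NOT a proof
of OSC, NOT summit progress.  No cell conditional (BetaPertH, (B), (B^μ)) occurs; no named fact is used.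

THE IDENTITY [kernel, this file].  For L ≥ 1 and block labels X, Y ∈ ℤ, with fine points x = X + i/L, y = Y + j/L,
i, j ∈ {0, …, L − 1}:
  (1/L²) Σ_{i,j} |x − y| = |X − Y| + δ_{X,Y} · (L² − 1)/(3L²)            (`blockAvgAbs_eq`)
i.e. block-averaging the kernel K(x, y) = |x − y| of the fine lattice (1/L)ℤ in BOTH arguments reproduces the kernel
of the unit lattice ℤ off the diagonal EXACTLY and adds the constant 2κ_L, κ_L := (L² − 1)/(6L²) (`kappa`), on the
diagonal; the core is Σ_{i<L} Σ_{j<L} |i − j| = L(L² − 1)/3 (`three_mul_sum_sum_abs_sub`).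

DICTIONARY [analysis of this seat — NOT asserted by any declaration].  −½|x − y| is the fundamental solution of the
second-difference operator in one dimension; in the Riemann-sum normalisation (weight 1/L on (1/L)ℤ, weight 1 on ℤ;
Q₁ = block mean, Q₁* = piecewise-constant injection) the identity reads Q₁ G′ Q₁* = G − κ_L·1 on mean-zero finitely
supported data (G, G′ the Green's operators of the unit and of the spacing-1/L Laplacians), hence for the ONE-STEP
EFFECTIVE Laplacian Δ₁^eff := (Q₁ G′ Q₁*)⁻¹ of exact (harmonic) block interpolation:
  (Δ₁^eff)⁻¹ = Δ⁻¹ − κ_L,   Δ₁^eff = Δ(1 − κ_LΔ)⁻¹,   M := Δ₁^eff − Δ = κ_L Δ²(1 − κ_LΔ)⁻¹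
(0 ≤ κ_LΔ ≤ 4κ_L < 2/3 on the spectrum [0, 4] of Δ), so the linearised one-step classical correction current
J^δ = M·(background) is EXACTLY a bounded operator of fourth order — in physical units κ_L η² Δ_η²(1 − κ_L η²Δ_η)⁻¹,
dimension six, irrelevant — the closed 1D form of the record's symbol statement M̂(p) = κ_L p⁴ + O(p⁶).  [toy, this
seat, pure Python < 1 s: the Fourier form Σ_{m=0}^{L−1} sin²(p/2)/(4L⁴ sin⁴((p + 2πm)/(2L))) − 1/(4 sin²(p/2)) = −κ_L
holds to 12 digits for L = 2, 3, 4, 5, 7 at p ∈ {0.05, 0.4, 1, 2, 3, π}; in d = 2 with block means the shift is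
direction-dependent (−0.125 along an axis, −0.0866 at (1,1), −0.0716 at (2,2) for L = 2), i.e. NOT a constant: the
exact constant shift is a one-dimensional phenomenon, the fourth-order bound is not.]  Printed templates of the
mechanism (PUBLISHED, outside the audited series; cell CITED-FACTS F-T6, S-t4lit12-5): C. King, Commun. Math. Phys. 102
(1986) "(4.7)" «|D^{−1}(p) − (|p|² + m²(L^kε)²)^{−1}| ≤ CL^{−2k}»; Glimm–Jaffe, *Quantum Physics* (1987) "(9.5.25)"
«0 ≤ k² − λ_k^δ = Σ_{α=1}^d k_α²(1 − [sin θ_α^δ/θ_α^δ]²) ≤ O(1)Σ_{α=1}^d k_α²(θ_α^δ)² ≤ O(1)∣k∣⁴δ², (9.5.25)» — quoted as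
context, never as hypotheses.  [cite: King1986, (4.7) p. 670]
-/

namespace Literature.MathematicalPhysics.QuantumFieldTheory.Balaban1983to89.T4OneStepKernel1D

open Finset

/-! ## §1 The combinatorial core: Σ_{i<L} Σ_{j<L} |i − j| = L(L² − 1)/3 -/

/-- One row against the new index: `Σ_{j<n} |n − j| = Σ_{j<n} (n − j)` and twice it is `n(n+1)`. [folklore] -/
theorem two_mul_sum_range_abs_sub (n : ℕ) :
    2 * ∑ j ∈ range n, |(n : ℤ) - j| = n * (n + 1) := by
  have h : ∀ j ∈ range n, |(n : ℤ) - j| = (n : ℤ) - j := by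
    intro j hj
    rw [mem_range] at hj
    exact abs_of_nonneg (by omega)
  rw [sum_congr rfl h, sum_sub_distrib, sum_const, card_range]
  have gauss := Finset.sum_range_id_mul_two n
  simp only [nsmul_eq_mul]
  have : (∑ j ∈ range n, (j : ℤ)) * 2 = (n : ℤ) * (n - 1) := by
    have := congrArg (fun m : ℕ => (m : ℤ)) gauss
    push_cast at this
    rw [← Nat.cast_sum] 
    rcases Nat.eq_zero_or_pos n with h0 | hpos
    · subst h0; simp
    · have : ((n - 1 : ℕ) : ℤ) = (n : ℤ) - 1 := by omega
      rw [← this]; exact_mod_cast gauss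
  nlinarith [this]

/-- **Σ_{i<L} Σ_{j<L} |i − j| = L(L² − 1)/3**, stated without division: `3 · ΣΣ|i − j| = L³ − L`. [folklore] -/
theorem three_mul_sum_sum_abs_sub (L : ℕ) :
    3 * ∑ i ∈ range L, ∑ j ∈ range L, |(i : ℤ) - j| = (L : ℤ) ^ 3 - L := by
  induction L with
  | zero => simp
  | succ n ih =>
    -- peel the last row and the last column
    have hcol : ∀ i ∈ range n, ∑ j ∈ range (n + 1), |(i : ℤ) - j| =
        ∑ j ∈ range n, |(i : ℤ) - j| + |(i : ℤ) - n| := by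
      intro i _; rw [sum_range_succ]
    rw [sum_range_succ, sum_congr rfl hcol, sum_add_distrib, sum_range_succ]
    have hsymm : ∑ i ∈ range n, |(i : ℤ) - n| = ∑ j ∈ range n, |(n : ℤ) - j| := by
      refine sum_congr rfl fun i _ => ?_
      rw [abs_sub_comm]
    rw [hsymm, sub_self, abs_zero, add_zero]
    have hrow := two_mul_sum_range_abs_sub n
    push_cast
    nlinarith [ih, hrow]

/-! ## §2 The double block average of |x − y| -/

/-- κ_L := (L² − 1)/(6L²) — the diagonal shift of the block-averaged one-dimensional kernel (half of it); the
coefficient of the record's fourth-order symbol κ_L p⁴. [folklore] -/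
noncomputable def kappa (L : ℕ) : ℝ := ((L : ℝ) ^ 2 - 1) / (6 * (L : ℝ) ^ 2)

/-- The double block average of the kernel |x − y| over the blocks with labels X, Y (fine points X + i/L, Y + j/L,
0 ≤ i, j < L, each block carrying the uniform weight 1/L). [folklore] -/
noncomputable def blockAvgAbs (L : ℕ) (X Y : ℤ) : ℝ :=
  (1 / (L : ℝ) ^ 2) * ∑ i ∈ range L, ∑ j ∈ range L, |(X : ℝ) - Y + ((i : ℝ) - j) / L|

/-- Inside one pair of DISTINCT blocks the kernel is affine in each fine variable with the sign of X − Y, so the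
offsets average out: for X > Y every term equals X − Y + (i − j)/L ≥ 1 − (L−1)/L > 0 (any i ≥ 0, j < L). [folklore] -/
theorem abs_term_of_lt {L : ℕ} (hL : 0 < L) {X Y : ℤ} (hXY : Y < X) (i : ℕ) {j : ℕ} (hj : j < L) :
    |(X : ℝ) - Y + ((i : ℝ) - j) / L| = (X : ℝ) - Y + ((i : ℝ) - j) / L := by
  have hL' : (0 : ℝ) < L := by exact_mod_cast hL
  have h1 : (1 : ℝ) ≤ (X : ℝ) - Y := by
    have : Y + 1 ≤ X := hXY
    have := (Int.cast_le (R := ℝ)).mpr this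
    push_cast at this; linarith
  have h2 : -1 < ((i : ℝ) - j) / L := by
    rw [lt_div_iff₀ hL']
    have : (j : ℝ) ≤ (L : ℝ) - 1 := by
      have : j + 1 ≤ L := hj
      have := (Nat.cast_le (α := ℝ)).mpr this
      push_cast at this; linarith
    have : (0 : ℝ) ≤ i := Nat.cast_nonneg i
    linarith
  exact abs_of_pos (by linarith)

/-- The offsets have total zero: `Σ_{i<L} Σ_{j<L} (i − j) = 0`. [folklore] -/
theorem sum_sum_sub_eq_zero (L : ℕ) : ∑ i ∈ range L, ∑ j ∈ range L, ((i : ℝ) - j) = 0 := by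
  simp only [sum_sub_distrib, sum_const, card_range, nsmul_eq_mul]
  rw [← mul_sum]
  ring

/-- **Off-diagonal: exact reproduction.**  For distinct blocks the double block average of |x − y| is |X − Y|.
[folklore] -/
theorem blockAvgAbs_of_ne {L : ℕ} (hL : 0 < L) {X Y : ℤ} (hXY : X ≠ Y) :
    blockAvgAbs L X Y = |(X : ℝ) - Y| := by
  have hL' : (0 : ℝ) < L := by exact_mod_cast hL
  have hL2 : (L : ℝ) ^ 2 ≠ 0 := by positivity
  -- reduce to Y < X by symmetry of both sides
  wlog hlt : Y < X generalizing X Y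
  · have hlt' : X < Y := lt_of_le_of_ne (not_lt.mp hlt) hXY
    have := this hXY.symm hlt'
    rw [abs_sub_comm, ← this]
    unfold blockAvgAbs
    congr 1
    rw [sum_comm]
    refine sum_congr rfl fun i _ => sum_congr rfl fun j _ => ?_
    rw [← abs_neg]; congr 1; ring
  unfold blockAvgAbs
  have hterm : ∀ i ∈ range L, ∀ j ∈ range L,
      |(X : ℝ) - Y + ((i : ℝ) - j) / L| = ((X : ℝ) - Y) + ((i : ℝ) - j) / L := by
    intro i _ j hj
    exact abs_term_of_lt hL hlt i (mem_range.mp hj)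
  rw [sum_congr rfl fun i hi => sum_congr rfl fun j hj => hterm i hi j hj]
  simp only [sum_add_distrib, sum_const, card_range, nsmul_eq_mul]
  have hoff : ∑ i ∈ range L, ∑ j ∈ range L, ((i : ℝ) - j) / L = 0 := by
    simp_rw [← sum_div]
    rw [sum_sum_sub_eq_zero, zero_div]
  rw [hoff, add_zero]
  have hpos : (0 : ℝ) < (X : ℝ) - Y := by
    have : Y + 1 ≤ X := hlt
    have := (Int.cast_le (R := ℝ)).mpr this
    push_cast at this; linarith
  rw [abs_of_pos hpos]
  field_simp

/-- **Diagonal: the constant 2κ_L.**  Within one block the double average of |x − y| is (L² − 1)/(3L²) = 2κ_L.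
[folklore] -/
theorem blockAvgAbs_self {L : ℕ} (hL : 0 < L) (X : ℤ) : blockAvgAbs L X X = 2 * kappa L := by
  have hL' : (0 : ℝ) < L := by exact_mod_cast hL
  unfold blockAvgAbs kappa
  have hterm : ∀ i ∈ range L, ∀ j ∈ range L,
      |(X : ℝ) - X + ((i : ℝ) - j) / L| = |((i : ℤ) : ℝ) - ((j : ℤ) : ℝ)| / L := by
    intro i _ j _
    rw [sub_self, zero_add, abs_div, abs_of_pos hL']
    push_cast; rfl
  rw [sum_congr rfl fun i hi => sum_congr rfl fun j hj => hterm i hi j hj]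
  simp_rw [← sum_div]
  have hcore : (∑ i ∈ range L, ∑ j ∈ range L, |((i : ℤ) : ℝ) - ((j : ℤ) : ℝ)|) = ((L : ℝ) ^ 3 - L) / 3 := by
    have h := three_mul_sum_sum_abs_sub L
    have h' := congrArg (fun z : ℤ => (z : ℝ)) h
    push_cast at h'
    simp only [Int.cast_natCast] at h' ⊢
    linarith
  rw [hcore]
  field_simp
  ring

/-- **The identity.**  `blockAvgAbs L X Y = |X − Y| + (if X = Y then 2κ_L else 0)`: the block-averaged fine kernel
is the coarse kernel plus a constant multiple of the identity. [folklore] -/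
theorem blockAvgAbs_eq {L : ℕ} (hL : 0 < L) (X Y : ℤ) :
    blockAvgAbs L X Y = |(X : ℝ) - Y| + (if X = Y then 2 * kappa L else 0) := by
  by_cases h : X = Y
  · subst h; rw [if_pos rfl, blockAvgAbs_self hL, sub_self, abs_zero, zero_add]
  · rw [if_neg h, blockAvgAbs_of_ne hL h, add_zero]

/-- κ_L lies in [1/8, 1/6) for L ≥ 2 (κ₂ = 1/8, κ₃ = 4/27, κ₄ = 5/32, κ_L ↑ 1/6), so 0 ≤ κ_LΔ ≤ 4κ_L < 2/3 on the
spectrum [0, 4] of the unit second-difference operator: the closed form M = κ_LΔ²(1 − κ_LΔ)⁻¹ of the DICTIONARY is a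
bounded operator. [folklore] -/
theorem kappa_lt_one_sixth {L : ℕ} (hL : 0 < L) : kappa L < 1 / 6 := by
  unfold kappa
  have hL' : (0 : ℝ) < (L : ℝ) ^ 2 := by positivity
  rw [div_lt_div_iff₀ (by positivity) (by norm_num)]
  nlinarith

/-- Lower bound κ_L ≥ 1/8 for L ≥ 2 (κ₂ = 1/8 and κ_L increases with L). [folklore] -/
theorem one_eighth_le_kappa {L : ℕ} (hL : 2 ≤ L) : 1 / 8 ≤ kappa L := by
  unfold kappa
  have hL' : (2 : ℝ) ≤ L := by exact_mod_cast hL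
  have hsq : (4 : ℝ) ≤ (L : ℝ) ^ 2 := by nlinarith
  rw [div_le_div_iff₀ (by norm_num) (by positivity)]
  nlinarith

/-! ## §3 Non-vacuity: the values quoted in the record -/

example : kappa 2 = 1 / 8 := by unfold kappa; norm_num
example : kappa 3 = 4 / 27 := by unfold kappa; norm_num
example : kappa 4 = 5 / 32 := by unfold kappa; norm_num
/-- L = 2, one block: the four fine pairs (0,0), (0,½), (½,0), (½,½) give (0 + ½ + ½ + 0)/4 = 1/4 = 2κ₂. -/
example : blockAvgAbs 2 0 0 = 1 / 4 := by
  rw [blockAvgAbs_self (by norm_num)]; unfold kappa; norm_num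
/-- L = 2, adjacent blocks: (1 + ½ + 3/2 + 1)/4 = 1 = |1 − 0|. -/
example : blockAvgAbs 2 1 0 = 1 := by
  rw [blockAvgAbs_of_ne (by norm_num) (by norm_num)]; norm_num

end Literature.MathematicalPhysics.QuantumFieldTheory.Balaban1983to89.T4OneStepKernel1D
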